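import Literature.Analysis.Complex.HadamardGenusZeroProofs
import Literature.Analysis.Complex.LaguerrePolya
import Literature.Analysis.Complex.DeBruijnUniversalFactors
import HarnessLib

/-!
# de Bruijn's Theorem 6: real entire functions of order `< 2` with roots in a strip are limits of real polynomials with roots in the strip — proofs

Trunk T-ANT support (complex analysis), companion file of
`Literature/Analysis/Complex/DeBruijnUniversalFactors.lean`. It DISCHARGES the named fact
`Literature.Analysis.Complex.DeBruijn1950.thm6` (N. G. de Bruijn, *The roots of trigonometric
integrals*, Duke Math. J. **17** (1950), 197–226, **Thm. 6**, p. 202): if the real entire function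
`f` has order `< 2` (`‖f z‖ ≤ C e^{‖z‖^ρ}`, `ρ < 2`) and its roots lie in the strip `|Im z| ≤ Δ`
(`Δ ≥ 0`), then there are real polynomials `pₙ` with all roots in that strip and `pₙ → f`
locally uniformly (`Literature.Analysis.Complex.DeBruijn1950.thm6_holds`).

## Proof

de Bruijn (p. 202) writes, by Hadamard's factorisation theorem in genus `≤ 1`,
`f = A zᵐ e^{az} ∏ (1 − z/ρ) e^{z/ρ}` with `a` real and uses `e^{az} = lim (1 + az/n)ⁿ`. The tree
has Hadamard's theorem only in genus `0` (`Literature.Analysis.Complex.hadamard_genus_zero_holds`);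
instead of the genus-`1` factorisation we prove directly the finite-radius statement that de
Bruijn's argument actually consumes, by the method of Titchmarsh's Lemma α already in the tree
(`Literature.Analysis.Complex.titchmarsh_logDeriv_sub_sum`, file `LogDerivZeros.lean`), pushed one
Cauchy estimate further:

* (`exists_linearised_factorisation`) for `f(0) ≠ 0` and every `R > 0`, on `|z| < R`,
  `f(z) = f(0) · ∏_{f(a)=0, |a| ≤ R} (1 − z/a)^{m(a)} · e^{φ_R(z)}` with `φ_R(0) = 0`,
  `φ_R'(0) = f'(0)/f(0) + ∑_{|a| ≤ R} m(a)/a` and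
  `|φ_R(z) − φ_R'(0) z| ≤ 64 (log(M(2R)/|f(0)|) + 1) |z|²/R²` for `|z| ≤ R/8`
  (divide out the zeros with their true multiplicities `m(a) = ord_a f`, maximum modulus on
  `|z| = 2R`, Borel–Carathéodory for `log`, two Cauchy estimates, two mean value inequalities);
* since `log M(2R) = O(R^ρ) = o(R²)`, the *linearised partial products*
  `f(0) ∏_{|a| ≤ R} (1 − z/a)^{m(a)} e^{λ_R z}`, `λ_R = φ_R'(0)`, converge to `f` uniformly on
  bounded sets (`linearised_partialProduct_approx`); no convergence of `∑ 1/|a|²` or of `λ_R` is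
  needed;
* for `f` real, conjugation symmetry of the zeros WITH multiplicities (`analyticOrderAt_conj`)
  makes `λ_R` real (`im_linCoeff_eq_zero`) and the partial product a real polynomial
  (`exists_real_polynomial_eval_eq`, via `Polynomial.lifts`), whose roots are roots of `f`;
* as in the source, `e^{λ_R z}` is replaced by `(1 + λ_R z/N)^N` (roots `−N/λ_R ∈ ℝ`), with the
  explicit bound `‖(1 + w/N)^N − e^w‖ ≤ ‖w‖² e^{‖w‖}/N` (`norm_one_add_div_pow_sub_exp_le`) and
  `N = N_R → ∞` fast enough (diagonal choice, `thm6_of_apply_zero_ne_zero`);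
* a zero of `f` at the origin is removed first (`exists_eq_pow_mul_of_entire`, `f = zⁿ g`), and
  the approximants of `g` are multiplied by `Xⁿ` (`thm6_holds`).

Everything in this file is PROVED; no new definitions or named facts.

## References

* N. G. de Bruijn, *The roots of trigonometric integrals*, Duke Math. J. 17 (1950), 197–226,
  Thm. 6 (p. 202) and its proof. [cite: Bruijn1950, Thm. 6]
* E. C. Titchmarsh, *The theory of the Riemann zeta-function*, 2nd ed., Oxford 1986, §3.9,
  Lemma α (the device replacing Hadamard's factorisation).
-/

noncomputable section

open Complex Filter Metric Set Topology

namespace Literature.Analysis.Complex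

namespace DeBruijn1950

open HadamardGenusZero (zerosIn mem_zerosIn zero_not_mem_zerosIn norm_pos_of_mem_zerosIn
  analyticOrderAt_eq_analyticOrderNatAt)

variable {f : ℂ → ℂ}
/-! ## Part A: dividing out the zeros of norm `≤ R`, with the true multiplicities -/

/-- In a factorisation `f = ∏_{b ∈ S} (z − b)^{m(b)} · g` on an open set `U` with `g` zero-free on
`U`, the exponent `m(a)` at `a ∈ S ∩ U` is the vanishing order of `f` at `a`. [folklore] -/
theorem analyticOrderAt_eq_of_eq_prod_mul {U : Set ℂ} (hU : IsOpen U)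
    {S : Finset ℂ} {m : ℂ → ℕ} {g : ℂ → ℂ} (hg : DifferentiableOn ℂ g U)
    (hg0 : ∀ z ∈ U, g z ≠ 0) (hfg : ∀ z ∈ U, f z = (∏ b ∈ S, (z - b) ^ m b) * g z)
    {a : ℂ} (haU : a ∈ U) (haS : a ∈ S) : analyticOrderAt f a = m a := by
  classical
  have hev : f =ᶠ[𝓝 a] ((fun z ↦ ∏ b ∈ S, (z - b) ^ m b) * g) :=
    Filter.eventuallyEq_of_mem (hU.mem_nhds haU) fun z hz ↦ by
      rw [hfg z hz]; rfl
  rw [analyticOrderAt_congr hev]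
  have hga : AnalyticAt ℂ g a := hg.analyticAt (hU.mem_nhds haU)
  have hPa : AnalyticAt ℂ (fun z ↦ ∏ b ∈ S, (z - b) ^ m b) a :=
    (differentiable_prod_pow_sub S m).analyticAt a
  rw [analyticOrderAt_mul hPa hga, hga.analyticOrderAt_eq_zero.2 (hg0 a haU), add_zero]
  have hsplit : (fun z ↦ ∏ b ∈ S, (z - b) ^ m b) =
      (fun z ↦ (z - a) ^ m a) * (fun z ↦ ∏ b ∈ S.erase a, (z - b) ^ m b) := by
    funext z
    simp only [Pi.mul_apply]
    rw [Finset.mul_prod_erase S (fun b ↦ (z - b) ^ m b) haS]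
  have h1a : AnalyticAt ℂ (fun z ↦ (z - a) ^ m a) a :=
    (show Differentiable ℂ (fun z ↦ (z - a) ^ m a) by fun_prop).analyticAt a
  have h2a : AnalyticAt ℂ (fun z ↦ ∏ b ∈ S.erase a, (z - b) ^ m b) a :=
    (differentiable_prod_pow_sub (S.erase a) m).analyticAt a
  rw [hsplit, analyticOrderAt_mul h1a h2a]
  have h1 : analyticOrderAt (fun z ↦ (z - a) ^ m a) a = m a :=
    analyticOrderAt_centeredMonomial
  have h2 : analyticOrderAt (fun z ↦ ∏ b ∈ S.erase a, (z - b) ^ m b) a = 0 := by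
    rw [h2a.analyticOrderAt_eq_zero]
    exact Finset.prod_ne_zero_iff.2 fun b hb ↦
      pow_ne_zero _ (sub_ne_zero.2 (Finset.ne_of_mem_erase hb).symm)
  rw [h1, h2, add_zero]

/-- **Division by the zeros of norm `≤ R`.** For `f` entire with `f(0) ≠ 0` and `0 < R < R'`:
`f(z) = ∏_{f(a) = 0, |a| ≤ R} (z − a)^{m(a)} · g(z)` on `|z| < R'`, with `m(a)` the vanishing
order of `f` at `a` and `g` holomorphic on `|z| < R'` and zero-free on `|z| ≤ R`. [folklore] -/
theorem exists_eq_zerosIn_prod_mul (hf : Differentiable ℂ f) (h0 : f 0 ≠ 0) {R R' : ℝ}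
    (hRR' : R < R') :
    ∃ g : ℂ → ℂ, DifferentiableOn ℂ g (ball 0 R') ∧ (∀ z ∈ closedBall (0 : ℂ) R, g z ≠ 0) ∧
      ∀ z ∈ ball (0 : ℂ) R',
        f z = (∏ a ∈ zerosIn hf h0 R, (z - a) ^ analyticOrderNatAt f a) * g z := by
  classical
  obtain ⟨S₀, m, g₀, hS₀, hS₀', hg₀, hg₀0, hfg₀⟩ := exists_finset_zeros_eq_prod_mul hf h0 R'
  -- the multiplicities are the vanishing orders
  have hm : ∀ a ∈ S₀, m a = analyticOrderNatAt f a := by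
    intro a ha
    have h := analyticOrderAt_eq_of_eq_prod_mul isOpen_ball hg₀ hg₀0 hfg₀ (hS₀ a ha).2.2 ha
    have : (analyticOrderNatAt f a : ℕ∞) = (m a : ℕ∞) := by
      rw [← analyticOrderAt_eq_analyticOrderNatAt hf h0 a, h]
    exact_mod_cast this.symm
  set S₂ : Finset ℂ := S₀.filter (fun a ↦ ¬‖a‖ ≤ R) with hS₂
  have hS : S₀.filter (fun a ↦ ‖a‖ ≤ R) = zerosIn hf h0 R := by
    ext a
    rw [Finset.mem_filter, mem_zerosIn]
    constructor
    · rintro ⟨ha, haR⟩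
      exact ⟨haR, (hS₀ a ha).1⟩
    · rintro ⟨haR, hfa⟩
      exact ⟨hS₀' a (mem_ball_zero_iff.2 (haR.trans_lt hRR')) hfa, haR⟩
  refine ⟨fun z ↦ (∏ a ∈ S₂, (z - a) ^ m a) * g₀ z,
    ((differentiable_prod_pow_sub S₂ m).differentiableOn).mul hg₀, fun z hz ↦ ?_, fun z hz ↦ ?_⟩
  · have hz' : z ∈ ball (0 : ℂ) R' :=
      mem_ball_zero_iff.2 ((mem_closedBall_zero_iff.1 hz).trans_lt hRR')
    refine mul_ne_zero (prod_pow_sub_ne_zero m fun a ha h ↦ ?_) (hg₀0 z hz')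
    rw [hS₂, Finset.mem_filter] at ha
    exact ha.2 (h ▸ mem_closedBall_zero_iff.1 hz)
  · rw [hfg₀ z hz, ← Finset.prod_filter_mul_prod_filter_not S₀ (fun a ↦ ‖a‖ ≤ R), mul_assoc]
    congr 1
    rw [← hS]
    refine Finset.prod_congr rfl fun a ha ↦ ?_
    rw [hm a (Finset.mem_filter.1 ha).1]

/-! ## Part B: the linearised factorisation on `|z| ≤ R/8` -/

/-- **Linearised local factorisation (Titchmarsh's Lemma α architecture, one Cauchy estimate
further).** Let `f` be entire with `f(0) ≠ 0`, `R > 0` and `‖f‖ ≤ M` on `|z| ≤ 2R`. Then on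
`|z| < R`, `f(z) = f(0) · ∏_{f(a)=0, |a| ≤ R} (1 − z/a)^{m(a)} · e^{φ(z)}` with `φ` holomorphic,
`φ(0) = 0`, `φ'(0) = f'(0)/f(0) + ∑ m(a)/a`, and
`‖φ(z) − φ'(0) z‖ ≤ 64 (log(M/|f(0)|) + 1) |z|²/R²` for `|z| ≤ R/8` (divide out the zeros,
maximum modulus on `|z| = 2R`, Borel–Carathéodory for `log`, two Cauchy estimates, two mean value
inequalities). [cite: Titchmarsh1986, §3.9 Lemma α] -/
theorem exists_linearised_factorisation (hf : Differentiable ℂ f) (h0 : f 0 ≠ 0) {R M : ℝ}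
    (hR : 0 < R) (hM : ∀ z ∈ closedBall (0 : ℂ) (2 * R), ‖f z‖ ≤ M) :
    ∃ φ : ℂ → ℂ, DifferentiableOn ℂ φ (ball 0 R) ∧ φ 0 = 0 ∧
      deriv φ 0 = deriv f 0 / f 0 +
        ∑ a ∈ zerosIn hf h0 R, (analyticOrderNatAt f a : ℂ) / a ∧
      (∀ z ∈ ball (0 : ℂ) R, f z = f 0 *
        (∏ a ∈ zerosIn hf h0 R, (1 - z / a) ^ analyticOrderNatAt f a) * exp (φ z)) ∧
      ∀ z ∈ closedBall (0 : ℂ) (R / 8),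
        ‖φ z - deriv φ 0 * z‖ ≤ 64 * (Real.log (M / ‖f 0‖) + 1) / R ^ 2 * ‖z‖ ^ 2 := by
  classical
  set S : Finset ℂ := zerosIn hf h0 R with hSdef
  set m : ℂ → ℕ := fun a ↦ analyticOrderNatAt f a with hmdef
  obtain ⟨g, hgd, hg0, hfg⟩ :=
    exists_eq_zerosIn_prod_mul hf h0 (show R < 3 * R by linarith)
  set P₁ : ℂ → ℂ := fun z ↦ ∏ a ∈ S, (z - a) ^ m a with hP₁
  have h3R : closedBall (0 : ℂ) (2 * R) ⊆ ball 0 (3 * R) := closedBall_subset_ball (by linarith)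
  have hcR : (0 : ℂ) ∈ ball (0 : ℂ) R := mem_ball_self hR
  have hc3R : (0 : ℂ) ∈ ball (0 : ℂ) (3 * R) := mem_ball_self (by linarith)
  have hfg' : ∀ z ∈ ball (0 : ℂ) (3 * R), f z = P₁ z * g z := fun z hz ↦ hfg z hz
  have hSmem : ∀ a ∈ S, f a = 0 ∧ ‖a‖ ≤ R := fun a ha ↦
    ⟨((mem_zerosIn hf h0).1 ha).2, ((mem_zerosIn hf h0).1 ha).1⟩
  have hnotS : ∀ z, f z ≠ 0 → ∀ a ∈ S, z ≠ a := fun z hz a ha h ↦ hz (h ▸ (hSmem a ha).1)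
  have hP₁c : P₁ 0 ≠ 0 := prod_pow_sub_ne_zero m (hnotS 0 h0)
  have hgc : g 0 ≠ 0 := hg0 0 (mem_closedBall_self hR.le)
  have hfc : f 0 = P₁ 0 * g 0 := hfg' 0 hc3R
  -- Step 2: `‖P₁ 0‖ ≤ ‖P₁ z‖` on the sphere `‖z‖ = 2R`, hence `‖g‖ ≤ M / ‖P₁ 0‖` there.
  have hP₁sphere : ∀ z ∈ sphere (0 : ℂ) (2 * R), ‖P₁ 0‖ ≤ ‖P₁ z‖ := by
    intro z hz
    refine norm_prod_pow_sub_le m fun a ha ↦ ?_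
    have ha' : ‖a‖ ≤ R := (hSmem a ha).2
    have hz' : ‖z - 0‖ = 2 * R := mem_sphere_iff_norm.1 hz
    have h1 : ‖z - 0‖ ≤ ‖z - a‖ + ‖a - 0‖ := norm_sub_le_norm_sub_add_norm_sub z a 0
    simp only [sub_zero] at h1 hz'
    rw [zero_sub, norm_neg]
    linarith
  have hgsphere : ∀ z ∈ sphere (0 : ℂ) (2 * R), ‖g z‖ ≤ M / ‖P₁ 0‖ := by
    intro z hz
    have hP₁z : 0 < ‖P₁ z‖ := (norm_pos_iff.2 hP₁c).trans_le (hP₁sphere z hz)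
    have hfz : ‖f z‖ = ‖P₁ z‖ * ‖g z‖ := by
      rw [hfg' z (h3R (sphere_subset_closedBall hz)), norm_mul]
    rw [le_div_iff₀ (norm_pos_iff.2 hP₁c)]
    calc ‖g z‖ * ‖P₁ 0‖ ≤ ‖g z‖ * ‖P₁ z‖ := by gcongr; exact hP₁sphere z hz
      _ = ‖f z‖ := by rw [hfz, mul_comm]
      _ ≤ M := hM z (sphere_subset_closedBall hz)
  -- Step 3: maximum modulus on `‖z‖ ≤ 2R`.
  have hgball : ∀ z ∈ closedBall (0 : ℂ) (2 * R), ‖g z‖ ≤ M / ‖P₁ 0‖ := by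
    intro z hz
    have h2R : (2 * R) ≠ 0 := by positivity
    refine Complex.norm_le_of_forall_mem_frontier_norm_le isBounded_ball
      (hgd.diffContOnCl_ball h3R) ?_ ?_
    · rw [frontier_ball (0 : ℂ) h2R]; exact hgsphere
    · rw [closure_ball (0 : ℂ) h2R]; exact hz
  -- Step 4: the normalised function `h = g / g 0` and its logarithm on `B(0, R)`.
  set h : ℂ → ℂ := fun z ↦ g z / g 0 with hh
  have hhd : DifferentiableOn ℂ h (ball 0 R) :=
    (hgd.mono (ball_subset_ball (by linarith))).div_const _
  have hh0 : ∀ z ∈ ball (0 : ℂ) R, h z ≠ 0 := fun z hz ↦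
    div_ne_zero (hg0 z (ball_subset_closedBall hz)) hgc
  have hMfc : ‖f 0‖ ≤ M := hM 0 (mem_closedBall_self (by linarith))
  have hfc0 : 0 < ‖f 0‖ := norm_pos_iff.2 h0
  have hM0 : 0 < M := hfc0.trans_le hMfc
  have hhbound : ∀ z ∈ ball (0 : ℂ) R, ‖h z‖ ≤ M / ‖f 0‖ := by
    intro z hz
    have hz' : z ∈ closedBall (0 : ℂ) (2 * R) := closedBall_subset_closedBall (by linarith)
      (ball_subset_closedBall hz)
    have e1 : ‖h z‖ = ‖g z‖ / ‖g 0‖ := by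
      show ‖g z / g 0‖ = _
      exact norm_div _ _
    rw [e1, hfc, norm_mul (P₁ 0) (g 0), ← div_div]
    exact div_le_div_of_nonneg_right (hgball z hz') (norm_nonneg _)
  obtain ⟨φ, hφd, hφc, hφ', hφexp⟩ := exists_log_on_ball hhd hh0
  have hhc : h 0 = 1 := div_self hgc
  have hφre : ∀ z ∈ ball (0 : ℂ) R, (φ z).re ≤ Real.log (M / ‖f 0‖) := by
    intro z hz
    have h1 : ‖h z‖ = Real.exp (φ z).re := by
      rw [hφexp z hz, hhc, one_mul, Complex.norm_exp]
    have h2 : Real.exp (φ z).re ≤ M / ‖f 0‖ := h1 ▸ hhbound z hz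
    have h3 : 0 < M / ‖f 0‖ := div_pos hM0 hfc0
    calc (φ z).re = Real.log (Real.exp (φ z).re) := (Real.log_exp _).symm
      _ ≤ Real.log (M / ‖f 0‖) := Real.log_le_log (Real.exp_pos _) h2
  set A : ℝ := Real.log (M / ‖f 0‖) + 1 with hA
  have hlog0 : 0 ≤ Real.log (M / ‖f 0‖) := Real.log_nonneg ((one_le_div hfc0).2 hMfc)
  have hA0 : 0 < A := by linarith
  -- Step 5: Borel–Carathéodory: `‖φ z‖ ≤ 2A` for `‖z‖ ≤ R/2`.
  have hBC : ∀ z ∈ closedBall (0 : ℂ) (R / 2), ‖φ z‖ ≤ 2 * A := by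
    intro z hz
    have hzc : ‖z‖ ≤ R / 2 := mem_closedBall_zero_iff.1 hz
    have hw : z ∈ ball (0 : ℂ) R := mem_ball_zero_iff.2 (by linarith)
    have hF₁ : MapsTo φ (ball 0 R) {z | z.re ≤ A} := fun w hw ↦
      (hφre w hw).trans (by linarith)
    have key := Complex.borelCaratheodory_zero hA0 hφd hF₁ hR hw hφc
    calc ‖φ z‖ ≤ 2 * A * ‖z‖ / (R - ‖z‖) := key
      _ ≤ 2 * A := by
          rw [div_le_iff₀ (by linarith)]
          nlinarith
  -- Step 6: Cauchy's estimate, twice.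
  set ψ : ℂ → ℂ := deriv φ with hψ
  have hψd : DifferentiableOn ℂ ψ (ball 0 R) := hφd.deriv isOpen_ball
  have hψbound : ∀ z ∈ closedBall (0 : ℂ) (R / 4), ‖ψ z‖ ≤ 8 * A / R := by
    intro z hz
    have hzc : ‖z‖ ≤ R / 4 := mem_closedBall_zero_iff.1 hz
    have hsub : closedBall z (R / 4) ⊆ ball 0 R := by
      intro w hw
      rw [mem_closedBall_iff_norm] at hw
      apply mem_ball_zero_iff.2
      calc ‖w‖ = ‖(w - z) + z‖ := by rw [sub_add_cancel]
        _ ≤ ‖w - z‖ + ‖z‖ := norm_add_le _ _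
        _ < R := by linarith
    have hsph : ∀ w ∈ sphere z (R / 4), ‖φ w‖ ≤ 2 * A := by
      intro w hw
      refine hBC w (mem_closedBall_zero_iff.2 ?_)
      have hw' : ‖w - z‖ = R / 4 := mem_sphere_iff_norm.1 hw
      calc ‖w‖ = ‖(w - z) + z‖ := by rw [sub_add_cancel]
        _ ≤ ‖w - z‖ + ‖z‖ := norm_add_le _ _
        _ ≤ R / 2 := by linarith
    have key := Complex.norm_deriv_le_of_forall_mem_sphere_norm_le (by positivity)
      (hφd.diffContOnCl_ball hsub) hsph
    calc ‖ψ z‖ = ‖deriv φ z‖ := rfl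
      _ ≤ 2 * A / (R / 4) := key
      _ = 8 * A / R := by field_simp; ring
  have hψ'bound : ∀ z ∈ closedBall (0 : ℂ) (R / 8), ‖deriv ψ z‖ ≤ 64 * A / R ^ 2 := by
    intro z hz
    have hzc : ‖z‖ ≤ R / 8 := mem_closedBall_zero_iff.1 hz
    have hsub : closedBall z (R / 8) ⊆ ball 0 R := by
      intro w hw
      rw [mem_closedBall_iff_norm] at hw
      apply mem_ball_zero_iff.2
      calc ‖w‖ = ‖(w - z) + z‖ := by rw [sub_add_cancel]
        _ ≤ ‖w - z‖ + ‖z‖ := norm_add_le _ _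
        _ < R := by linarith
    have hsph : ∀ w ∈ sphere z (R / 8), ‖ψ w‖ ≤ 8 * A / R := by
      intro w hw
      refine hψbound w (mem_closedBall_zero_iff.2 ?_)
      have hw' : ‖w - z‖ = R / 8 := mem_sphere_iff_norm.1 hw
      calc ‖w‖ = ‖(w - z) + z‖ := by rw [sub_add_cancel]
        _ ≤ ‖w - z‖ + ‖z‖ := norm_add_le _ _
        _ ≤ R / 4 := by linarith
    have key := Complex.norm_deriv_le_of_forall_mem_sphere_norm_le (by positivity)
      (hψd.diffContOnCl_ball hsub) hsph
    calc ‖deriv ψ z‖ ≤ 8 * A / R / (R / 8) := key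
      _ = 64 * A / R ^ 2 := by field_simp; ring
  -- Step 7: two mean value inequalities: `‖φ z - ψ 0 z‖ ≤ (64 A / R²) ‖z‖²` on `‖z‖ ≤ R/8`.
  have hsub8 : closedBall (0 : ℂ) (R / 8) ⊆ ball 0 R := closedBall_subset_ball (by linarith)
  have hmv1 : ∀ w ∈ closedBall (0 : ℂ) (R / 8), ‖ψ w - ψ 0‖ ≤ 64 * A / R ^ 2 * ‖w‖ := by
    intro w hw
    have := (convex_closedBall (0 : ℂ) (R / 8)).norm_image_sub_le_of_norm_deriv_le
      (fun u hu ↦ hψd.differentiableAt (isOpen_ball.mem_nhds (hsub8 hu)))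
      (fun u hu ↦ hψ'bound u hu) (mem_closedBall_self (by positivity)) hw
    simpa using this
  have hrem : ∀ z ∈ closedBall (0 : ℂ) (R / 8), ‖φ z - ψ 0 * z‖ ≤ 64 * A / R ^ 2 * ‖z‖ ^ 2 := by
    intro z hz
    have hzc : ‖z‖ ≤ R / 8 := mem_closedBall_zero_iff.1 hz
    set E : ℂ → ℂ := fun w ↦ φ w - ψ 0 * w with hE
    have hEd : ∀ w ∈ ball (0 : ℂ) R, HasDerivAt E (ψ w - ψ 0) w := by
      intro w hw
      have h1 : HasDerivAt φ (ψ w) w :=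
        (hφd.differentiableAt (isOpen_ball.mem_nhds hw)).hasDerivAt
      have h2 : HasDerivAt (fun u : ℂ ↦ ψ 0 * u) (ψ 0) w := by
        simpa using (hasDerivAt_id w).const_mul (ψ 0)
      exact h1.sub h2
    have hsubz : closedBall (0 : ℂ) ‖z‖ ⊆ closedBall 0 (R / 8) := closedBall_subset_closedBall hzc
    have key := (convex_closedBall (0 : ℂ) ‖z‖).norm_image_sub_le_of_norm_hasDerivWithin_le
      (f := E) (f' := fun w ↦ ψ w - ψ 0) (C := 64 * A / R ^ 2 * ‖z‖)
      (fun w hw ↦ (hEd w (hsub8 (hsubz hw))).hasDerivWithinAt)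
      (fun w hw ↦ ?_) (mem_closedBall_self (norm_nonneg z)) (mem_closedBall_zero_iff.2 le_rfl)
    · have hE0 : E 0 = 0 := by simp [hE, hφc]
      rw [hE0, sub_zero, sub_zero] at key
      calc ‖φ z - ψ 0 * z‖ = ‖E z‖ := rfl
        _ ≤ 64 * A / R ^ 2 * ‖z‖ * ‖z‖ := key
        _ = 64 * A / R ^ 2 * ‖z‖ ^ 2 := by ring
    · calc ‖ψ w - ψ 0‖ ≤ 64 * A / R ^ 2 * ‖w‖ := hmv1 w (hsubz hw)
        _ ≤ 64 * A / R ^ 2 * ‖z‖ := by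
            gcongr
            exact mem_closedBall_zero_iff.1 hw
  -- Step 8: the value `ψ 0 = f'(0)/f(0) + ∑ m(a)/a`.
  have hψ0 : ψ 0 = deriv f 0 / f 0 + ∑ a ∈ S, (m a : ℂ) / a := by
    have hP₁d : DifferentiableAt ℂ P₁ 0 := (differentiable_prod_pow_sub S m) 0
    have hgd0 : DifferentiableAt ℂ g 0 := hgd.differentiableAt (isOpen_ball.mem_nhds hc3R)
    have hev : f =ᶠ[𝓝 0] fun w ↦ P₁ w * g w :=
      Filter.eventuallyEq_of_mem (isOpen_ball.mem_nhds hc3R) fun w hw ↦ hfg' w hw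
    have hdf : deriv f 0 = deriv P₁ 0 * g 0 + P₁ 0 * deriv g 0 := by
      rw [hev.deriv_eq]
      exact deriv_mul hP₁d hgd0
    have hdh : deriv h 0 / h 0 = deriv g 0 / g 0 := by
      have : deriv h 0 = deriv g 0 / g 0 := by
        show deriv (fun w ↦ g w / g 0) 0 = _
        exact deriv_div_const _
      rw [this, hh]
      field_simp
    have hP₁ld : deriv P₁ 0 / P₁ 0 = ∑ a ∈ S, (m a : ℂ) / (0 - a) :=
      deriv_prod_pow_sub_div m (hnotS 0 h0)
    have hsum : ∑ a ∈ S, (m a : ℂ) / a = -(deriv P₁ 0 / P₁ 0) := by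
      rw [hP₁ld, ← Finset.sum_neg_distrib]
      refine Finset.sum_congr rfl fun a _ ↦ ?_
      rw [zero_sub, div_neg]
      ring
    rw [hsum, hψ, (hφ' 0 hcR).deriv, hdh, hdf, hfc]
    field_simp
    ring
  -- Step 9: the factorisation on `B(0, R)`.
  have hfact : ∀ z ∈ ball (0 : ℂ) R,
      f z = f 0 * (∏ a ∈ S, (1 - z / a) ^ m a) * exp (φ z) := by
    intro z hz
    have hz3 : z ∈ ball (0 : ℂ) (3 * R) := ball_subset_ball (by linarith) hz
    have hgz : g z = g 0 * exp (φ z) := by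
      have h1 := hφexp z hz
      rw [hhc, one_mul] at h1
      have h2 : g z = h z * g 0 := by rw [hh]; field_simp
      rw [h2, h1, mul_comm]
    have hprod : P₁ z = P₁ 0 * ∏ a ∈ S, (1 - z / a) ^ m a := by
      rw [hP₁]
      simp only
      rw [← Finset.prod_mul_distrib]
      refine Finset.prod_congr rfl fun a ha ↦ ?_
      have ha0 : a ≠ 0 := fun h ↦ zero_not_mem_zerosIn hf h0 R (h ▸ ha)
      rw [← mul_pow]
      congr 1
      field_simp
      ring
    rw [hfg' z hz3, hgz, hprod, hfc]
    ring
  refine ⟨φ, hφd, hφc, ?_, hfact, fun z hz ↦ ?_⟩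
  · exact hψ0
  · exact hrem z hz
/-! ## Part C: conjugation symmetry for real `f` -/

open scoped ComplexConjugate

/-- Transport of an `∀ᶠ` statement at `a` to `conj a` along complex conjugation. [folklore] -/
theorem eventually_nhds_conj {p : ℂ → Prop} {a : ℂ} (h : ∀ᶠ z in 𝓝 a, p z) :
    ∀ᶠ w in 𝓝 (conj a), p (conj w) := by
  have ht : Tendsto (fun w : ℂ ↦ conj w) (𝓝 (conj a)) (𝓝 a) := by
    simpa using (Complex.continuous_conj.tendsto (conj a))
  exact ht.eventually h

/-- For `f` with `f(z̄) = (f z)^*` the vanishing order is conjugation invariant: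
`ord_{ā} f = ord_a f`. [folklore] -/
theorem analyticOrderAt_conj (hf : Differentiable ℂ f) (hsymm : ∀ z, f (conj z) = conj (f z))
    (a : ℂ) : analyticOrderAt f (conj a) = analyticOrderAt f a := by
  have hfw : ∀ w, f w = conj (f (conj w)) := fun w ↦ by
    rw [hsymm, Complex.conj_conj]
  cases h : analyticOrderAt f a with
  | top =>
    rw [analyticOrderAt_eq_top] at h ⊢
    filter_upwards [eventually_nhds_conj h] with w hw
    rw [hfw w, hw, map_zero]
  | coe n =>
    obtain ⟨g, hga, hgne, hfg⟩ := ((hf.analyticAt a).analyticOrderAt_eq_natCast).1 h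
    rw [((hf.analyticAt (conj a)).analyticOrderAt_eq_natCast)]
    refine ⟨fun w ↦ conj (g (conj w)), ?_, by simpa using hgne, ?_⟩
    · -- analyticity of `conj ∘ g ∘ conj` at `conj a`
      rw [analyticAt_iff_eventually_differentiableAt]
      have hgd : ∀ᶠ z in 𝓝 a, DifferentiableAt ℂ g z :=
        hga.eventually_analyticAt.mono fun z hz ↦ hz.differentiableAt
      filter_upwards [eventually_nhds_conj hgd] with w hw
      have := hw.conj_conj
      rw [Complex.conj_conj] at this
      exact this
    · filter_upwards [eventually_nhds_conj hfg] with w hw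
      rw [hfw w, hw]
      simp only [smul_eq_mul, map_mul, map_pow, map_sub, Complex.conj_conj]

/-- `analyticOrderNatAt f ā = analyticOrderNatAt f a` for `f` real (cf.
`Literature.Analysis.Complex.Obreschkoff.analyticOrderNatAt_conj`, the same under the extra
hypothesis `f 0 ≠ 0`, in a file with unrelated heavy imports). [folklore] -/
theorem analyticOrderNatAt_conj (hf : Differentiable ℂ f) (hsymm : ∀ z, f (conj z) = conj (f z))
    (a : ℂ) : analyticOrderNatAt f (conj a) = analyticOrderNatAt f a := by
  rw [analyticOrderNatAt, analyticOrderNatAt, analyticOrderAt_conj hf hsymm a]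

/-- The zero set in `|u| ≤ R` is conjugation invariant for `f` real. [folklore] -/
theorem conj_mem_zerosIn (hf : Differentiable ℂ f) (h0 : f 0 ≠ 0)
    (hsymm : ∀ z, f (conj z) = conj (f z)) {R : ℝ} {a : ℂ} (ha : a ∈ zerosIn hf h0 R) :
    conj a ∈ zerosIn hf h0 R := by
  rw [mem_zerosIn] at ha ⊢
  exact ⟨by rw [Complex.norm_conj]; exact ha.1, by rw [hsymm, ha.2, map_zero]⟩

/-- Realness of `∑_{f(a)=0, |a| ≤ R} m(a)/a` for `f` real. [folklore] -/
theorem im_sum_zerosIn_eq_zero (hf : Differentiable ℂ f) (h0 : f 0 ≠ 0)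
    (hsymm : ∀ z, f (conj z) = conj (f z)) (R : ℝ) :
    (∑ a ∈ zerosIn hf h0 R, (analyticOrderNatAt f a : ℂ) / a).im = 0 := by
  rw [← Complex.conj_eq_iff_im, map_sum]
  refine Finset.sum_nbij' (fun a ↦ conj a) (fun a ↦ conj a)
    (fun a ha ↦ conj_mem_zerosIn hf h0 hsymm ha) (fun a ha ↦ conj_mem_zerosIn hf h0 hsymm ha)
    (fun a _ ↦ Complex.conj_conj a) (fun a _ ↦ Complex.conj_conj a) fun a _ ↦ ?_
  rw [map_div₀, Complex.conj_natCast, analyticOrderNatAt_conj hf hsymm a]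

/-- Realness of the linear coefficient `f'(0)/f(0) + ∑ m(a)/a` for `f` real. [folklore] -/
theorem im_linCoeff_eq_zero (hf : Differentiable ℂ f) (h0 : f 0 ≠ 0)
    (hreal : ∀ x : ℝ, (f x).im = 0) (R : ℝ) :
    (deriv f 0 / f 0 + ∑ a ∈ zerosIn hf h0 R, (analyticOrderNatAt f a : ℂ) / a).im = 0 := by
  have hsymm : ∀ z, f (conj z) = conj (f z) := apply_conj_eq_conj hf hreal
  rw [Complex.add_im, im_sum_zerosIn_eq_zero hf h0 hsymm R, add_zero]
  have e1 : deriv f 0 = ((deriv f 0).re : ℂ) :=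
    Complex.ext (by simp) (by simpa using im_deriv_ofReal hf hreal 0)
  have e2 : f 0 = ((f 0).re : ℂ) := Complex.ext (by simp) (by simpa using hreal 0)
  rw [e1, e2, ← Complex.ofReal_div, Complex.ofReal_im]

open Polynomial in
/-- The partial product `f(0) ∏ (1 − z/a)^{m(a)}` is (the complex evaluation of) a REAL
polynomial when `f` is real. [folklore] -/
theorem exists_real_polynomial_eval_eq (hf : Differentiable ℂ f) (h0 : f 0 ≠ 0)
    (hreal : ∀ x : ℝ, (f x).im = 0) (R : ℝ) :
    ∃ q : Polynomial ℝ, ∀ z : ℂ, (q.map (algebraMap ℝ ℂ)).eval z =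
      f 0 * ∏ a ∈ zerosIn hf h0 R, (1 - z / a) ^ analyticOrderNatAt f a := by
  classical
  have hsymm : ∀ z, f (conj z) = conj (f z) := apply_conj_eq_conj hf hreal
  set P : Polynomial ℂ := Polynomial.C (f 0) *
    ∏ a ∈ zerosIn hf h0 R, (1 - Polynomial.C a⁻¹ * X) ^ analyticOrderNatAt f a with hP
  -- `P` is invariant under coefficientwise conjugation
  have hPconj : P.map (starRingEnd ℂ) = P := by
    rw [hP, Polynomial.map_mul, Polynomial.map_C, Polynomial.map_prod]
    have hf0 : (starRingEnd ℂ) (f 0) = f 0 := by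
      have e2 : f 0 = ((f 0).re : ℂ) := Complex.ext (by simp) (by simpa using hreal 0)
      rw [e2, Complex.conj_ofReal]
    rw [hf0]
    congr 1
    refine Finset.prod_nbij' (fun a ↦ conj a) (fun a ↦ conj a)
      (fun a ha ↦ conj_mem_zerosIn hf h0 hsymm ha) (fun a ha ↦ conj_mem_zerosIn hf h0 hsymm ha)
      (fun a _ ↦ Complex.conj_conj a) (fun a _ ↦ Complex.conj_conj a) fun a _ ↦ ?_
    rw [Polynomial.map_pow, Polynomial.map_sub, Polynomial.map_one, Polynomial.map_mul,
      Polynomial.map_C, Polynomial.map_X, map_inv₀, analyticOrderNatAt_conj hf hsymm a]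
  -- hence lifts to `ℝ[X]`
  have hlift : P ∈ Polynomial.lifts (algebraMap ℝ ℂ) := by
    rw [Polynomial.lifts_iff_coeff_lifts]
    intro n
    have hc : (starRingEnd ℂ) (P.coeff n) = P.coeff n := by
      conv_rhs => rw [← hPconj]
      rw [Polynomial.coeff_map]
    refine ⟨(P.coeff n).re, ?_⟩
    rw [Complex.coe_algebraMap]
    exact Complex.conj_eq_iff_re.1 hc
  obtain ⟨q, hq⟩ := (Polynomial.mem_lifts P).1 hlift
  refine ⟨q, fun z ↦ ?_⟩
  rw [hq, hP, Polynomial.eval_mul, Polynomial.eval_C, Polynomial.eval_prod]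
  congr 1
  refine Finset.prod_congr rfl fun a _ ↦ ?_
  rw [Polynomial.eval_pow, Polynomial.eval_sub, Polynomial.eval_one, Polynomial.eval_mul,
    Polynomial.eval_C, Polynomial.eval_X]
  congr 1
  rw [div_eq_mul_inv, mul_comm]

/-! ## Part D: `f(0) ∏_{|a| ≤ R} (1 − z/a)^{m(a)} e^{λ_R z} → f` uniformly on bounded sets -/

/-- Normalisation of the growth hypothesis: from `‖f z‖ ≤ C exp (‖z‖^ρ)` (`ρ < 2`, any `C`) to
`‖f z‖ ≤ C' exp (‖z‖^σ)` with `σ = max ρ 0 ∈ [0, 2)` and `C' ≥ 1`. [folklore] -/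
theorem growth_normalise_two (hf : Differentiable ℂ f) {ρ C : ℝ} (hρ : ρ < 2)
    (hb : ∀ z : ℂ, ‖f z‖ ≤ C * Real.exp (‖z‖ ^ ρ)) :
    ∃ σ C' : ℝ, 0 ≤ σ ∧ σ < 2 ∧ 1 ≤ C' ∧ ∀ z : ℂ, ‖f z‖ ≤ C' * Real.exp (‖z‖ ^ σ) := by
  obtain ⟨M₀, hM₀⟩ := (isCompact_closedBall (0 : ℂ) 1).exists_bound_of_continuousOn
    hf.continuous.continuousOn
  refine ⟨max ρ 0, max (max |C| 1) M₀, le_max_right _ _, max_lt hρ (by norm_num),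
    le_trans (le_max_right _ _) (le_max_left _ _), fun z => ?_⟩
  by_cases hz : ‖z‖ ≤ 1
  · calc ‖f z‖ ≤ M₀ := hM₀ z (mem_closedBall_zero_iff.mpr hz)
      _ ≤ M₀ * Real.exp (‖z‖ ^ max ρ 0) := by
          have hM : 0 ≤ M₀ := (norm_nonneg _).trans (hM₀ 0 (by simp))
          have : 1 ≤ Real.exp (‖z‖ ^ max ρ 0) := Real.one_le_exp (by positivity)
          nlinarith
      _ ≤ max (max |C| 1) M₀ * Real.exp (‖z‖ ^ max ρ 0) := by
          gcongr; exact le_max_right _ _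
  · rw [not_le] at hz
    calc ‖f z‖ ≤ C * Real.exp (‖z‖ ^ ρ) := hb z
      _ ≤ |C| * Real.exp (‖z‖ ^ ρ) := by gcongr; exact le_abs_self C
      _ ≤ |C| * Real.exp (‖z‖ ^ max ρ 0) := by
          apply mul_le_mul_of_nonneg_left _ (abs_nonneg C)
          exact Real.exp_le_exp.mpr (Real.rpow_le_rpow_of_exponent_le hz.le (le_max_left _ _))
      _ ≤ max (max |C| 1) M₀ * Real.exp (‖z‖ ^ max ρ 0) := by
          gcongr; exact le_trans (le_max_left _ _) (le_max_left _ _)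

/-- **The linearised partial products converge to `f` uniformly on bounded sets.** For `f`
entire of order `< 2` (`‖f z‖ ≤ C e^{‖z‖^σ}`, `0 ≤ σ < 2`) with `f(0) ≠ 0`:
`f(0) · ∏_{f(a)=0, |a| ≤ R} (1 − z/a)^{m(a)} · exp ((f'(0)/f(0) + ∑_{|a| ≤ R} m(a)/a) z) → f(z)`
uniformly on `|z| ≤ r`, as `R → ∞`. (This is what de Bruijn's proof of his Thm. 6 takes from
Hadamard's factorisation, obtained here without the factorisation theorem, from
`exists_linearised_factorisation` and `log M(2R) = O(R^σ) = o(R²)`.) [folklore] -/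
theorem linearised_partialProduct_approx (hf : Differentiable ℂ f) (h0 : f 0 ≠ 0) {σ C : ℝ}
    (hσ0 : 0 ≤ σ) (hσ : σ < 2) (hgr : ∀ z, ‖f z‖ ≤ C * Real.exp (‖z‖ ^ σ)) (r : ℝ) {ε : ℝ}
    (hε : 0 < ε) :
    ∀ᶠ R : ℝ in atTop, ∀ z : ℂ, ‖z‖ ≤ r →
      ‖f 0 * (∏ a ∈ zerosIn hf h0 R, (1 - z / a) ^ analyticOrderNatAt f a) *
          exp ((deriv f 0 / f 0 + ∑ a ∈ zerosIn hf h0 R, (analyticOrderNatAt f a : ℂ) / a) * z)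
        - f z‖ < ε := by
  have hCpos : 0 < C := growthConst_pos hgr h0
  have hf0 : 0 < ‖f 0‖ := norm_pos_iff.2 h0
  set r₀ : ℝ := max r 0 with hr₀
  have hr₀0 : 0 ≤ r₀ := le_max_right _ _
  set K : ℝ := Real.log C - Real.log ‖f 0‖ + 1 with hK
  set Mr : ℝ := C * Real.exp (r₀ ^ σ) with hMr
  have hMr0 : 0 < Mr := by positivity
  have hfr : ∀ z : ℂ, ‖z‖ ≤ r → ‖f z‖ ≤ Mr := fun z hz ↦
    (hgr z).trans (mul_le_mul_of_nonneg_left (Real.exp_le_exp.2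
      (Real.rpow_le_rpow (norm_nonneg z) (hz.trans (le_max_left r 0)) hσ0)) hCpos.le)
  -- the error term `B_R = 64 (K + (2R)^σ)/R² → 0`
  have hlim : Tendsto (fun R : ℝ ↦ 64 * ((K + (|(0 : ℝ)| + 2 * R) ^ σ) / R ^ 2) * r₀ ^ 2)
      atTop (𝓝 0) := by
    simpa using ((tendsto_growth_div_sq K 0 hσ0 hσ).const_mul 64).mul_const (r₀ ^ 2)
  have hev1 : ∀ᶠ R : ℝ in atTop, 64 * ((K + (|(0 : ℝ)| + 2 * R) ^ σ) / R ^ 2) * r₀ ^ 2 < 1 :=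
    hlim.eventually_lt_const one_pos
  have hev2 : ∀ᶠ R : ℝ in atTop,
      64 * ((K + (|(0 : ℝ)| + 2 * R) ^ σ) / R ^ 2) * r₀ ^ 2 < ε / (2 * Mr) :=
    hlim.eventually_lt_const (by positivity)
  filter_upwards [hev1, hev2, eventually_ge_atTop (8 * r₀ + 8)] with R hR1 hR2 hRge
  have hRpos : 0 < R := by linarith
  have hrR : r₀ ≤ R / 8 := by linarith
  -- Part B at radius `R`
  set M : ℝ := C * Real.exp ((|(0 : ℝ)| + 2 * R) ^ σ) with hM
  have hMb : ∀ z ∈ closedBall (0 : ℂ) (2 * R), ‖f z‖ ≤ M := by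
    have := norm_le_on_closedBall hσ0 hgr 0 R
    simpa only [Complex.ofReal_zero] using this
  obtain ⟨φ, -, -, hφ0, hfact, hrem⟩ := exists_linearised_factorisation hf h0 hRpos hMb
  have hlog : Real.log (M / ‖f 0‖) + 1 = K + (|(0 : ℝ)| + 2 * R) ^ σ := by
    rw [hK, hM, Real.log_div (by positivity) hf0.ne', Real.log_mul hCpos.ne' (Real.exp_pos _).ne',
      Real.log_exp]
    ring
  set B : ℝ := 64 * (Real.log (M / ‖f 0‖) + 1) / R ^ 2 with hB
  have hB' : B = 64 * ((K + (|(0 : ℝ)| + 2 * R) ^ σ) / R ^ 2) := by rw [hB, hlog]; ring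
  have hB0 : 0 ≤ B := by
    rw [hB']
    have : 0 ≤ K + (|(0 : ℝ)| + 2 * R) ^ σ := by
      rw [← hlog]
      have : 0 ≤ Real.log (M / ‖f 0‖) := Real.log_nonneg ((one_le_div hf0).2
        (hMb 0 (mem_closedBall_self (by linarith))))
      linarith
    positivity
  intro z hz
  have hz₀ : ‖z‖ ≤ r₀ := hz.trans (le_max_left _ _)
  have hz8 : z ∈ closedBall (0 : ℂ) (R / 8) := mem_closedBall_zero_iff.2 (hz₀.trans hrR)
  have hzR : z ∈ ball (0 : ℂ) R := mem_ball_zero_iff.2 (by linarith)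
  rw [← hφ0]
  set lam : ℂ := deriv φ 0 with hlam
  set Pz : ℂ := ∏ a ∈ zerosIn hf h0 R, (1 - z / a) ^ analyticOrderNatAt f a with hPz
  have hfz : f z = f 0 * Pz * exp (φ z) := hfact z hzR
  have hkey : f 0 * Pz * exp (lam * z) - f z = f z * (exp (-(φ z - lam * z)) - 1) := by
    rw [hfz, mul_sub, mul_one, mul_assoc (f 0 * Pz) (exp (φ z)), ← Complex.exp_add]
    congr 2
    ring
  have hsmall : ‖-(φ z - lam * z)‖ ≤ B * r₀ ^ 2 := by
    rw [norm_neg]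
    calc ‖φ z - lam * z‖ ≤ B * ‖z‖ ^ 2 := hrem z hz8
      _ ≤ B * r₀ ^ 2 := by gcongr
  have hBr1 : B * r₀ ^ 2 ≤ 1 := by rw [hB']; exact hR1.le
  rw [hkey, norm_mul]
  calc ‖f z‖ * ‖exp (-(φ z - lam * z)) - 1‖ ≤ Mr * (2 * (B * r₀ ^ 2)) := by
        gcongr
        · exact hfr z hz
        · exact (Complex.norm_exp_sub_one_le (hsmall.trans hBr1)).trans (by linarith)
    _ < Mr * (2 * (ε / (2 * Mr))) := by gcongr; rw [hB']; exact hR2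
    _ = ε := by field_simp

/-! ## Part E: from `e^{λz}` to `(1 + λz/N)^N`, real polynomials, and the diagonal sequence -/

/-- **Quantitative `(1 + w/N)^N → e^w`:** `‖(1 + w/N)^N − e^w‖ ≤ ‖w‖² e^{‖w‖}/N` for `‖w‖ ≤ N`.
[folklore] -/
theorem norm_one_add_div_pow_sub_exp_le {w : ℂ} {N : ℕ} (hN : 0 < N) (hw : ‖w‖ ≤ N) :
    ‖(1 + w / N) ^ N - exp w‖ ≤ ‖w‖ ^ 2 * Real.exp ‖w‖ / N := by
  set a : ℂ := exp (w / N) with ha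
  set b : ℂ := 1 + w / N with hb
  have hN0 : (0 : ℝ) < N := by exact_mod_cast hN
  have hN' : (N : ℂ) ≠ 0 := by exact_mod_cast hN.ne'
  have hnorm : ‖w / N‖ = ‖w‖ / N := by
    rw [norm_div]
    simp
  have hexp : exp w = a ^ N := by
    rw [ha, ← Complex.exp_nat_mul]
    congr 1
    field_simp
  have hwN : ‖w / N‖ ≤ 1 := by
    rw [hnorm]
    exact div_le_one_of_le₀ hw hN0.le
  have hab : ‖a - b‖ ≤ (‖w‖ / N) ^ 2 := by
    have := Complex.norm_exp_sub_one_sub_id_le hwN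
    rw [hnorm] at this
    rw [ha, hb, ← sub_sub]
    exact this
  have hea : ‖a‖ ≤ Real.exp (‖w‖ / N) := by
    rw [ha, Complex.norm_exp, ← hnorm]
    exact Real.exp_le_exp.2 (Complex.re_le_norm _)
  have heb : ‖b‖ ≤ Real.exp (‖w‖ / N) := by
    rw [hb]
    calc ‖1 + w / N‖ ≤ ‖(1 : ℂ)‖ + ‖w / N‖ := norm_add_le _ _
      _ = ‖w‖ / N + 1 := by rw [hnorm, norm_one, add_comm]
      _ ≤ Real.exp (‖w‖ / N) := Real.add_one_le_exp _
  have h1e : 1 ≤ Real.exp (‖w‖ / N) := Real.one_le_exp (by positivity)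
  have hterm : ∀ i ∈ Finset.range N, ‖a ^ i * b ^ (N - 1 - i)‖ ≤ Real.exp ‖w‖ := by
    intro i hi
    rw [Finset.mem_range] at hi
    rw [norm_mul, norm_pow, norm_pow]
    calc ‖a‖ ^ i * ‖b‖ ^ (N - 1 - i)
        ≤ Real.exp (‖w‖ / N) ^ i * Real.exp (‖w‖ / N) ^ (N - 1 - i) := by
          gcongr
      _ = Real.exp (‖w‖ / N) ^ (i + (N - 1 - i)) := by rw [pow_add]
      _ ≤ Real.exp (‖w‖ / N) ^ N := pow_le_pow_right₀ h1e (by omega)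
      _ = Real.exp ‖w‖ := by
          rw [← Real.exp_nat_mul]
          congr 1
          field_simp
  have hsum : ‖∑ i ∈ Finset.range N, a ^ i * b ^ (N - 1 - i)‖ ≤ N * Real.exp ‖w‖ := by
    calc ‖∑ i ∈ Finset.range N, a ^ i * b ^ (N - 1 - i)‖
        ≤ ∑ i ∈ Finset.range N, ‖a ^ i * b ^ (N - 1 - i)‖ := norm_sum_le _ _
      _ ≤ ∑ _i ∈ Finset.range N, Real.exp ‖w‖ := Finset.sum_le_sum hterm
      _ = N * Real.exp ‖w‖ := by rw [Finset.sum_const, Finset.card_range, nsmul_eq_mul]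
  have hgeom := geom_sum₂_mul a b N
  calc ‖(1 + w / N) ^ N - exp w‖ = ‖a ^ N - b ^ N‖ := by rw [hexp, ← hb, norm_sub_rev]
    _ = ‖∑ i ∈ Finset.range N, a ^ i * b ^ (N - 1 - i)‖ * ‖a - b‖ := by
        rw [← hgeom, norm_mul]
    _ ≤ N * Real.exp ‖w‖ * (‖w‖ / N) ^ 2 := by gcongr
    _ = ‖w‖ ^ 2 * Real.exp ‖w‖ / N := by field_simp

open Polynomial in
/-- Complex evaluation of the real polynomial `(1 + c X)^N`. [folklore] -/
theorem eval_map_one_add_C_mul_X_pow (c : ℝ) (N : ℕ) (z : ℂ) :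
    ((((1 : Polynomial ℝ) + Polynomial.C c * X) ^ N).map (algebraMap ℝ ℂ)).eval z =
      (1 + c * z) ^ N := by
  simp [Polynomial.eval_pow]

/-- The roots of `(1 + c z)^N` (`c` real) are real. [folklore] -/
theorem im_eq_zero_of_one_add_mul_pow_eq_zero {c : ℝ} {N : ℕ} {z : ℂ}
    (h : (1 + (c : ℂ) * z) ^ N = 0) : z.im = 0 := by
  have h1 : 1 + (c : ℂ) * z = 0 := by
    rcases Nat.eq_zero_or_pos N with hN | hN
    · subst hN; simp at h
    · exact pow_eq_zero_iff hN.ne' |>.1 h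
  have him := congrArg Complex.im h1
  have hre := congrArg Complex.re h1
  simp only [Complex.add_im, Complex.one_im, Complex.mul_im, Complex.ofReal_re, Complex.ofReal_im,
    zero_mul, add_zero, zero_add, Complex.zero_im] at him
  rcases mul_eq_zero.1 him with hc | hz
  · subst hc
    simp at hre
  · exact hz

/-- Locally uniform convergence on `ℂ` from uniform convergence on every closed ball. [folklore] -/
theorem tendstoLocallyUniformly_of_forall_closedBall {F : ℕ → ℂ → ℂ} {g : ℂ → ℂ}
    (h : ∀ r : ℝ, ∀ ε > 0, ∀ᶠ n in atTop, ∀ z : ℂ, ‖z‖ ≤ r → ‖F n z - g z‖ < ε) :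
    TendstoLocallyUniformly F g atTop := by
  rw [Metric.tendstoLocallyUniformly_iff]
  intro ε hε x
  refine ⟨closedBall x 1, closedBall_mem_nhds x one_pos, ?_⟩
  filter_upwards [h (‖x‖ + 1) ε hε] with n hn y hy
  rw [dist_eq_norm, norm_sub_rev]
  refine hn y ?_
  calc ‖y‖ = ‖(y - x) + x‖ := by rw [sub_add_cancel]
    _ ≤ ‖y - x‖ + ‖x‖ := norm_add_le _ _
    _ ≤ ‖x‖ + 1 := by rw [add_comm]; gcongr; exact mem_closedBall_iff_norm.1 hy

open Polynomial in
/-- **de Bruijn's Theorem 6 for `f(0) ≠ 0`**, with uniform convergence on bounded sets: real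
polynomials with roots in the strip, `→ f` uniformly on every disc. [cite: Bruijn1950, Thm. 6] -/
theorem thm6_of_apply_zero_ne_zero (hf : Differentiable ℂ f) (h0 : f 0 ≠ 0) {σ C : ℝ}
    (hσ0 : 0 ≤ σ) (hσ : σ < 2) (hgr : ∀ z, ‖f z‖ ≤ C * Real.exp (‖z‖ ^ σ))
    (hreal : ∀ x : ℝ, (f x).im = 0) {Δ : ℝ} (hΔ : 0 ≤ Δ) (hroots : RootsInStrip f Δ) :
    ∃ p : ℕ → Polynomial ℝ,
      (∀ n, RootsInStrip (fun z ↦ ((p n).map (algebraMap ℝ ℂ)).eval z) Δ) ∧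
      ∀ r : ℝ, ∀ ε > 0, ∀ᶠ n in atTop, ∀ z : ℂ, ‖z‖ ≤ r →
        ‖((p n).map (algebraMap ℝ ℂ)).eval z - f z‖ < ε := by
  classical
  -- the real polynomials `q k` with `q k (z) = f(0) ∏_{|a| ≤ k} (1 - z/a)^{m(a)}`
  have hq := fun k : ℕ ↦ exists_real_polynomial_eval_eq hf h0 hreal (k : ℝ)
  choose q hq using hq
  -- the real linear coefficients `lam k`
  set Λ : ℕ → ℂ := fun k ↦ deriv f 0 / f 0 +
    ∑ a ∈ zerosIn hf h0 (k : ℝ), (analyticOrderNatAt f a : ℂ) / a with hΛ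
  set lam : ℕ → ℝ := fun k ↦ (Λ k).re with hlam
  have hΛim : ∀ k, (Λ k).im = 0 := fun k ↦ by
    simp only [hΛ]
    exact im_linCoeff_eq_zero hf h0 hreal k
  have hlamΛ : ∀ k, ((lam k : ℝ) : ℂ) = Λ k := fun k ↦
    Complex.ext (by simp [hlam]) (by rw [Complex.ofReal_im, hΛim k])
  -- bounds `Bq k` for `q k` on `|z| ≤ k`
  have hBq : ∀ k : ℕ, ∃ B : ℝ, 0 ≤ B ∧
      ∀ z : ℂ, ‖z‖ ≤ k → ‖((q k).map (algebraMap ℝ ℂ)).eval z‖ ≤ B := by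
    intro k
    obtain ⟨B, hB⟩ := (isCompact_closedBall (0 : ℂ) k).exists_bound_of_continuousOn
      ((Polynomial.continuous _).continuousOn)
    exact ⟨max B 0, le_max_right _ _, fun z hz ↦
      (hB z (mem_closedBall_zero_iff.2 hz)).trans (le_max_left _ _)⟩
  choose Bq hBq0 hBq using hBq
  -- the exponents `N k`
  set W : ℕ → ℝ := fun k ↦ |lam k| * k with hW
  set N : ℕ → ℕ := fun k ↦ ⌈max (W k) ((k + 1) * Bq k * W k ^ 2 * Real.exp (W k))⌉₊ + 1 with hN
  have hNpos : ∀ k, 0 < N k := fun k ↦ Nat.succ_pos _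
  have hNW : ∀ k, W k ≤ N k := fun k ↦ by
    have h1 := Nat.le_ceil (max (W k) ((k + 1) * Bq k * W k ^ 2 * Real.exp (W k)))
    have h2 : (N k : ℝ) = ⌈max (W k) ((k + 1) * Bq k * W k ^ 2 * Real.exp (W k))⌉₊ + 1 := by
      simp [hN]
    rw [h2]
    linarith [le_max_left (W k) ((k + 1) * Bq k * W k ^ 2 * Real.exp (W k))]
  have hNB : ∀ k, (k + 1) * Bq k * W k ^ 2 * Real.exp (W k) ≤ N k := fun k ↦ by
    have h1 := Nat.le_ceil (max (W k) ((k + 1) * Bq k * W k ^ 2 * Real.exp (W k)))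
    have h2 : (N k : ℝ) = ⌈max (W k) ((k + 1) * Bq k * W k ^ 2 * Real.exp (W k))⌉₊ + 1 := by
      simp [hN]
    rw [h2]
    linarith [le_max_right (W k) ((k + 1) * Bq k * W k ^ 2 * Real.exp (W k))]
  -- the polynomials
  refine ⟨fun k ↦ q k * ((1 : Polynomial ℝ) + Polynomial.C (lam k / N k) * X) ^ N k,
    fun k z hz ↦ ?_, fun r ε hε ↦ ?_⟩
  · -- roots in the strip
    simp only [Polynomial.map_mul, Polynomial.eval_mul] at hz
    rcases mul_eq_zero.1 hz with hz1 | hz2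
    · rw [hq k z] at hz1
      rcases mul_eq_zero.1 hz1 with h01 | hprod
      · exact absurd h01 h0
      · obtain ⟨a, ha, hza⟩ := Finset.prod_eq_zero_iff.1 hprod
        have ha' := (mem_zerosIn hf h0).1 ha
        have ha0 : a ≠ 0 := fun h ↦ h0 (h ▸ ha'.2)
        have hza' : z = a := by
          have h1 : 1 - z / a = 0 := eq_zero_of_pow_eq_zero hza
          field_simp at h1
          linear_combination -h1
        rw [hza']
        exact hroots a ha'.2
    · rw [eval_map_one_add_C_mul_X_pow] at hz2
      rw [im_eq_zero_of_one_add_mul_pow_eq_zero hz2, abs_zero]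
      exact hΔ
  · -- convergence on `|z| ≤ r`
    have hD := linearised_partialProduct_approx hf h0 hσ0 hσ hgr r (half_pos hε)
    have hD' := tendsto_natCast_atTop_atTop.eventually hD
    have hev3 : ∀ᶠ k : ℕ in atTop, (1 : ℝ) / (k + 1) < ε / 2 := by
      have : Tendsto (fun k : ℕ ↦ (1 : ℝ) / (k + 1)) atTop (𝓝 0) := tendsto_one_div_add_atTop_nhds_zero_nat
      exact this.eventually_lt_const (half_pos hε)
    filter_upwards [hD', hev3, eventually_ge_atTop ⌈max r 0⌉₊] with k hk1 hk2 hk3 z hz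
    have hkr : r ≤ k := (le_max_left r 0).trans ((Nat.le_ceil _).trans (by exact_mod_cast hk3))
    have hzk : ‖z‖ ≤ k := hz.trans hkr
    -- the two approximations
    have hA := hk1 z hz
    set Q : ℂ := ((q k).map (algebraMap ℝ ℂ)).eval z with hQ
    have hQeq : Q = f 0 * ∏ a ∈ zerosIn hf h0 (k : ℝ), (1 - z / a) ^ analyticOrderNatAt f a := hq k z
    set w : ℂ := (lam k : ℂ) * z with hw
    have hwW : ‖w‖ ≤ W k := by
      rw [hw, norm_mul, Complex.norm_real, Real.norm_eq_abs]
      exact mul_le_mul_of_nonneg_left hzk (abs_nonneg _)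
    have hE := norm_one_add_div_pow_sub_exp_le (hNpos k) (hwW.trans (hNW k))
    have heval : (((q k * ((1 : Polynomial ℝ) + Polynomial.C (lam k / N k) * X) ^ N k)).map
        (algebraMap ℝ ℂ)).eval z = Q * (1 + w / N k) ^ N k := by
      rw [Polynomial.map_mul, Polynomial.eval_mul, eval_map_one_add_C_mul_X_pow, ← hQ]
      congr 2
      rw [hw]
      push_cast
      ring
    rw [heval]
    have hsplit : Q * (1 + w / N k) ^ N k - f z =
        Q * ((1 + w / N k) ^ N k - exp w) + (Q * exp w - f z) := by ring
    rw [hsplit]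
    have h1 : ‖Q * ((1 + w / N k) ^ N k - exp w)‖ ≤ 1 / (k + 1) := by
      rw [norm_mul]
      have hQB : ‖Q‖ ≤ Bq k := hBq k z hzk
      have hmono : ‖w‖ ^ 2 * Real.exp ‖w‖ ≤ W k ^ 2 * Real.exp (W k) := by
        gcongr
      have hNk : (0 : ℝ) < N k := by exact_mod_cast hNpos k
      calc ‖Q‖ * ‖(1 + w / N k) ^ N k - exp w‖ ≤ Bq k * (‖w‖ ^ 2 * Real.exp ‖w‖ / N k) :=
            mul_le_mul hQB hE (norm_nonneg _) (hBq0 k)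
        _ ≤ Bq k * (W k ^ 2 * Real.exp (W k) / N k) :=
            mul_le_mul_of_nonneg_left (div_le_div_of_nonneg_right hmono hNk.le) (hBq0 k)
        _ = (Bq k * W k ^ 2 * Real.exp (W k)) / N k := by ring
        _ ≤ 1 / ((k : ℝ) + 1) := by
            rw [div_le_div_iff₀ hNk (by positivity), one_mul]
            calc Bq k * W k ^ 2 * Real.exp (W k) * ((k : ℝ) + 1)
                = ((k : ℝ) + 1) * Bq k * W k ^ 2 * Real.exp (W k) := by ring
              _ ≤ (N k : ℝ) := hNB k
    have h2 : ‖Q * exp w - f z‖ < ε / 2 := by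
      rw [hQeq, hw, hlamΛ k]
      exact hA
    calc ‖Q * ((1 + w / N k) ^ N k - exp w) + (Q * exp w - f z)‖
        ≤ ‖Q * ((1 + w / N k) ^ N k - exp w)‖ + ‖Q * exp w - f z‖ := norm_add_le _ _
      _ < 1 / (k + 1) + ε / 2 := add_lt_add_of_le_of_lt h1 h2
      _ < ε / 2 + ε / 2 := by gcongr
      _ = ε := by ring

/-! ## Part F: removing the zero at the origin; proof of Theorem 6 -/

/-- An entire `f ≢ 0` is `z^n · g(z)` with `g` entire and `g(0) ≠ 0` (`n` the vanishing order at
`0`). [folklore] -/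
theorem exists_eq_pow_mul_of_entire (hf : Differentiable ℂ f) (hne : ∃ z, f z ≠ 0) :
    ∃ (n : ℕ) (g : ℂ → ℂ), Differentiable ℂ g ∧ g 0 ≠ 0 ∧ ∀ z, f z = z ^ n * g z := by
  classical
  have hfin : analyticOrderAt f 0 ≠ ⊤ := by
    intro htop
    rw [analyticOrderAt_eq_top] at htop
    obtain ⟨w, hw⟩ := hne
    exact hw ((hf.differentiableOn.analyticOnNhd isOpen_univ).eqOn_zero_of_preconnected_of_eventuallyEq_zero
      isPreconnected_univ (mem_univ 0) htop (mem_univ w))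
  set n : ℕ := analyticOrderNatAt f 0 with hn
  have hord : analyticOrderAt f 0 = n := (Nat.cast_analyticOrderNatAt hfin).symm
  obtain ⟨g₀, hg₀a, hg₀0, hfg₀⟩ := ((hf.analyticAt 0).analyticOrderAt_eq_natCast).1 hord
  simp only [sub_zero, smul_eq_mul] at hfg₀
  set g : ℂ → ℂ := fun z ↦ if z = 0 then g₀ 0 else f z / z ^ n with hg
  have hg0 : g 0 = g₀ 0 := by simp [hg]
  have hgev : g =ᶠ[𝓝 0] g₀ := by
    filter_upwards [hfg₀] with z hz
    by_cases hz0 : z = 0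
    · rw [hz0, hg0]
    · rw [hg]
      simp only [hz0, if_false]
      rw [hz, mul_div_cancel_left₀ _ (pow_ne_zero _ hz0)]
  have hfg : ∀ z, f z = z ^ n * g z := by
    intro z
    by_cases hz0 : z = 0
    · subst hz0
      rw [hg0]
      exact hfg₀.self_of_nhds
    · rw [hg]
      simp only [hz0, if_false]
      rw [mul_div_cancel₀ _ (pow_ne_zero _ hz0)]
  refine ⟨n, g, fun z ↦ ?_, by rwa [hg0], hfg⟩
  by_cases hz0 : z = 0
  · subst hz0
    exact (hg₀a.congr hgev.symm).differentiableAt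
  · have hev : g =ᶠ[𝓝 z] fun w ↦ f w / w ^ n := by
      filter_upwards [isOpen_ne.mem_nhds hz0] with w hw
      have hw' : w ≠ 0 := hw
      rw [hg]
      simp [hw']
    refine DifferentiableAt.congr_of_eventuallyEq ?_ hev
    exact ((hf z).div ((differentiable_pow n) z) (pow_ne_zero _ hz0))

/-- **Discharge of `DeBruijn1950.thm6` (de Bruijn 1950, Thm. 6, p. 202).** A real entire function
of order `< 2` whose roots lie in the strip `|Im z| ≤ Δ` is the locally uniform limit of real
polynomials whose roots lie in that strip. Proof: remove the zero at the origin, then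
`Literature.Analysis.Complex.DeBruijn1950.thm6_of_apply_zero_ne_zero` (Titchmarsh's Lemma α in
place of de Bruijn's appeal to Hadamard's factorisation theorem, and `e^{λz} = lim (1 + λz/N)^N`
as in the source). [cite: Bruijn1950, Thm. 6] -/
theorem thm6_holds : thm6 := by
  intro f Δ hΔ hent hreal hroots
  obtain ⟨hdiff, ρ, C, hρ, hgrowth⟩ := hent
  obtain ⟨n, g, hg, hg0, hfg⟩ := exists_eq_pow_mul_of_entire hdiff hroots.exists_ne_zero
  -- hypotheses for `g`
  have hgreal : ∀ x : ℝ, (g x).im = 0 := by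
    have hcont : Continuous fun x : ℝ ↦ (g x).im :=
      Complex.continuous_im.comp (hg.continuous.comp Complex.continuous_ofReal)
    have hzero : EqOn (fun x : ℝ ↦ (g x).im) (fun _ ↦ 0) ({(0 : ℝ)}ᶜ) := by
      intro x hx
      simp only [mem_compl_iff, mem_singleton_iff] at hx
      have hx' : (x : ℂ) ≠ 0 := by exact_mod_cast hx
      have h1 : g x = f x / (x : ℂ) ^ n := by
        rw [hfg x, mul_div_cancel_left₀ _ (pow_ne_zero _ hx')]
      have e2 : f x = ((f x).re : ℂ) := Complex.ext (by simp) (by simpa using hreal x)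
      simp only
      rw [h1, e2, ← Complex.ofReal_pow, ← Complex.ofReal_div, Complex.ofReal_im]
    have := hcont.ext_on (dense_compl_singleton 0) continuous_const hzero
    intro x
    exact congrFun this x
  have hgroots : RootsInStrip g Δ := fun z hz ↦ hroots z (by rw [hfg z, hz, mul_zero])
  have hggrowth : ∃ C' : ℝ, ∀ z, ‖g z‖ ≤ C' * Real.exp (‖z‖ ^ ρ) := by
    obtain ⟨M₁, hM₁⟩ := (isCompact_closedBall (0 : ℂ) 1).exists_bound_of_continuousOn
      hg.continuous.continuousOn
    refine ⟨max (max C 0) M₁, fun z ↦ ?_⟩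
    have hexp1 : 1 ≤ Real.exp (‖z‖ ^ ρ) := Real.one_le_exp (Real.rpow_nonneg (norm_nonneg z) ρ)
    by_cases hz : ‖z‖ ≤ 1
    · calc ‖g z‖ ≤ M₁ := hM₁ z (mem_closedBall_zero_iff.2 hz)
        _ ≤ max (max C 0) M₁ * 1 := by rw [mul_one]; exact le_max_right _ _
        _ ≤ max (max C 0) M₁ * Real.exp (‖z‖ ^ ρ) := by gcongr
    · rw [not_le] at hz
      have hz0 : z ≠ 0 := fun h ↦ by rw [h, norm_zero] at hz; linarith
      have hzn : 1 ≤ ‖z‖ ^ n := one_le_pow₀ hz.le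
      have h1 : ‖g z‖ ≤ ‖f z‖ := by
        rw [hfg z, norm_mul, norm_pow]
        exact le_mul_of_one_le_left (norm_nonneg _) hzn
      calc ‖g z‖ ≤ ‖f z‖ := h1
        _ ≤ C * Real.exp (‖z‖ ^ ρ) := hgrowth z
        _ ≤ max (max C 0) M₁ * Real.exp (‖z‖ ^ ρ) := by
            gcongr; exact le_trans (le_max_left C 0) (le_max_left _ _)
  obtain ⟨C', hC'⟩ := hggrowth
  obtain ⟨σ, C'', hσ0, hσ, -, hgr⟩ := growth_normalise_two hg hρ hC'
  obtain ⟨p, hproots, hpconv⟩ := thm6_of_apply_zero_ne_zero hg hg0 hσ0 hσ hgr hgreal hΔ hgroots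
  refine ⟨fun k ↦ Polynomial.X ^ n * p k, fun k z hz ↦ ?_, ?_⟩
  · simp only [Polynomial.map_mul, Polynomial.map_pow, Polynomial.map_X, Polynomial.eval_mul,
      Polynomial.eval_pow, Polynomial.eval_X] at hz
    rcases mul_eq_zero.1 hz with hz1 | hz2
    · rw [pow_eq_zero_iff'] at hz1
      rw [hz1.1, Complex.zero_im, abs_zero]
      exact hΔ
    · exact hproots k z hz2
  · refine tendstoLocallyUniformly_of_forall_closedBall fun r ε hε ↦ ?_
    set r₁ : ℝ := max r 1 with hr₁
    have hr₁1 : 1 ≤ r₁ := le_max_right _ _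
    have hε' : 0 < ε / r₁ ^ n := by positivity
    filter_upwards [hpconv r (ε / r₁ ^ n) hε'] with k hk z hz
    have hzr : ‖z‖ ^ n ≤ r₁ ^ n := pow_le_pow_left₀ (norm_nonneg _) (hz.trans (le_max_left _ _)) n
    simp only [Polynomial.map_mul, Polynomial.map_pow, Polynomial.map_X, Polynomial.eval_mul,
      Polynomial.eval_pow, Polynomial.eval_X]
    rw [hfg z, ← mul_sub, norm_mul, norm_pow]
    calc ‖z‖ ^ n * ‖((p k).map (algebraMap ℝ ℂ)).eval z - g z‖
        ≤ r₁ ^ n * ‖((p k).map (algebraMap ℝ ℂ)).eval z - g z‖ := by gcongr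
      _ < r₁ ^ n * (ε / r₁ ^ n) := by gcongr; exact hk z hz
      _ = ε := by field_simp

end DeBruijn1950

end Literature.Analysis.Complex
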